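import Mathlib

/-!
# Crux `WordLengthQP` (stmt-ValiantsHypothesis-6623), line `positive-monoid-exits` —
stub `stub_univariateReduction`: one variable for all variables

UNIVARIATE REDUCTION.  A real affine elementary word of width 3 is a list of letters
`l = (i, j, c, o) : Fin 3 × Fin 3 × ℝ × Option σ` with matrix `E_ij(c)` (`o = none`) or
`E_ij(c · x_v)` (`o = some v`), i.e. `Matrix.transvection i j (C c * o.elim 1 X)`; the value of a
word is the product of its letter matrices, the word is valid if `i ≠ j` letterwise, and its EXITS
are the letters that are not (positive coefficient and adjacent, `|i - j| = 1`).  Substituting ONE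
variable `t = X 0 : MvPolynomial (Fin 1) ℝ` for every `x_v` — the ring homomorphism
`MvPolynomial.rename (fun _ => 0)` — maps a valid word for `E₀₂(F)` to the valid word
`(i, j, c, o) ↦ (i, j, c, o.map (fun _ => 0))` for `E₀₂(F(t, …, t))`, of the same length and with
the same number of exits (positivity and adjacency of a letter only read `(i, j, c)`).

Proof: push the entrywise ring homomorphism `(rename _).toRingHom.mapMatrix` through the product
(`map_list_prod`, `List.map_map`); on a letter it acts through `rename_C`, `rename_X`, on the
target by `E₀₂(F) ↦ E₀₂(rename _ F)`.  The two counting identities are `List.length_map` and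
`List.filter_map`.

References: functoriality of elementary matrices under ring homomorphisms is folklore; the
univariate words are the objects of Lam–Pylyavskyy, *Total positivity in loop groups I* (2012),
which motivates the reduction but is not used.
-/

-- `Summit.ValiantsHypothesis.ValiantsHypothesis.…` is the tree's mandated single-conjunct layout
-- (Sub = Summit), so the duplicated namespace component is intended.
set_option linter.dupNamespace false

noncomputable section

namespace Summit.ValiantsHypothesis.ValiantsHypothesis.Cruxes.WordLengthQP.PositiveMonoidExits

/-- A ring homomorphism applied entrywise maps a transvection `E_ij(c)` to `E_ij(f c)`.
[folklore] -/
-- adapted from Theorems/ElementaryWordLengthWordPerSuperQuarticOfBlockHardness.lean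
-- (`transvection_map`)
theorem univariateReduction_transvection_map {m R S : Type*} [DecidableEq m] [CommRing R]
    [CommRing S] (f : R →+* S) (i j : m) (c : R) :
    (Matrix.transvection i j c).map f = Matrix.transvection i j (f c) := by
  ext k l
  simp only [Matrix.transvection, Matrix.map_apply, Matrix.add_apply, Matrix.one_apply,
    Matrix.single_apply]
  split_ifs <;> simp

/-- An entrywise ring homomorphism out of `MvPolynomial σ R` maps the matrix of a word to the
product of the mapped letters `E_ij(f (C c) · o.elim 1 (f ∘ X))`. [folklore] -/
-- adapted from Theorems/ElementaryWordLengthWordPerSuperQuarticOfBlockHardness.lean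
-- (`mapMatrix_wordProd`)
theorem univariateReduction_mapMatrix_wordProd {σ R S : Type*} [CommRing R] [CommRing S]
    (f : MvPolynomial σ R →+* S) (w : List (Fin 3 × Fin 3 × R × Option σ)) :
    f.mapMatrix (w.map (fun l => Matrix.transvection l.1 l.2.1
        (MvPolynomial.C l.2.2.1 * l.2.2.2.elim 1 MvPolynomial.X))).prod =
      (w.map (fun l => Matrix.transvection l.1 l.2.1
        (f (MvPolynomial.C l.2.2.1) * l.2.2.2.elim 1 (fun v => f (MvPolynomial.X v))))).prod := by
  rw [map_list_prod, List.map_map]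
  congr 1
  apply List.map_congr_left
  intro l _
  simp only [Function.comp_apply, RingHom.mapMatrix_apply,
    univariateReduction_transvection_map, map_mul]
  congr 2
  cases l.2.2.2 <;> simp

/-- Renaming the variable of every letter along `e : σ → τ` renames the word's matrix entrywise:
the word `(i, j, c, o.map e)` computes `(rename e).mapMatrix` of the original word's matrix.
[folklore] -/
-- adapted from Theorems/ElementaryWordLengthWordPerSuperQuarticOfBlockHardness.lean
-- (`rename_wordProd`)
theorem univariateReduction_rename_wordProd {σ τ R : Type*} [CommRing R] (e : σ → τ)
    (w : List (Fin 3 × Fin 3 × R × Option σ)) :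
    ((w.map (fun l => (l.1, l.2.1, l.2.2.1, l.2.2.2.map e))).map
        (fun l => Matrix.transvection l.1 l.2.1
          (MvPolynomial.C l.2.2.1 * l.2.2.2.elim 1 MvPolynomial.X : MvPolynomial τ R))).prod =
      (MvPolynomial.rename e).toRingHom.mapMatrix (w.map (fun l => Matrix.transvection l.1 l.2.1
        (MvPolynomial.C l.2.2.1 * l.2.2.2.elim 1 MvPolynomial.X))).prod := by
  rw [univariateReduction_mapMatrix_wordProd, List.map_map]
  congr 1
  apply List.map_congr_left
  intro l _
  simp only [Function.comp_apply, AlgHom.toRingHom_eq_coe, RingHom.coe_coe,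
    MvPolynomial.rename_C, MvPolynomial.rename_X]
  congr 2
  cases l.2.2.2 <;> simp

/-- **Univariate reduction.**  Substituting ONE variable `t` for every `x_v` maps a valid real
word for `E₀₂(F)` to a valid real word for `E₀₂(F(t,…,t))` with the SAME number of exits and the
same length: letterwise `(i, j, c, v) ↦ (i, j, c, v.map (fun _ => 0))`; whether a letter is an
exit depends only on `(i, j, c)`.  Consequence for the crux: every rung statement of the shape
"a nonnegative `F ≠ 0` whose monomials all have degree `≥ D` needs `> k` exits" is equivalent to
its univariate case, so the per/det-symmetric storey of the exit ladder lives on width-3 words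
over `ℝ[t]` with letters of degree `≤ 1`. [folklore; motivation: Lam–Pylyavskyy 2012, *Total
positivity in loop groups I*] -/
theorem stub_univariateReduction {σ : Type} (F : MvPolynomial σ ℝ)
    (w : List (Fin 3 × Fin 3 × ℝ × Option σ)) (hw : ∀ l ∈ w, l.1 ≠ l.2.1)
    (hF : (w.map (fun l => Matrix.transvection l.1 l.2.1
        (MvPolynomial.C l.2.2.1 * l.2.2.2.elim 1 MvPolynomial.X))).prod =
        Matrix.transvection (0 : Fin 3) 2 F) :
    ∃ w₁ : List (Fin 3 × Fin 3 × ℝ × Option (Fin 1)),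
      (∀ l ∈ w₁, l.1 ≠ l.2.1) ∧
      (w₁.map (fun l => Matrix.transvection l.1 l.2.1
        (MvPolynomial.C l.2.2.1 * l.2.2.2.elim 1 MvPolynomial.X))).prod =
        Matrix.transvection (0 : Fin 3) 2 (MvPolynomial.rename (fun _ : σ => (0 : Fin 1)) F) ∧
      (w₁.filter (fun l => !decide (0 < l.2.2.1 ∧
          (l.1.val + 1 = l.2.1.val ∨ l.2.1.val + 1 = l.1.val)))).length =
        (w.filter (fun l => !decide (0 < l.2.2.1 ∧
          (l.1.val + 1 = l.2.1.val ∨ l.2.1.val + 1 = l.1.val)))).length ∧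
      w₁.length = w.length := by
  refine ⟨w.map (fun l => (l.1, l.2.1, l.2.2.1, l.2.2.2.map (fun _ => (0 : Fin 1)))),
    ?_, ?_, ?_, ?_⟩
  · -- validity: the letter map does not touch `(i, j)`
    intro l hl
    obtain ⟨l', hl', rfl⟩ := List.mem_map.1 hl
    exact hw l' hl'
  · -- the product: functoriality of words under `rename`
    rw [univariateReduction_rename_wordProd, hF, RingHom.mapMatrix_apply,
      univariateReduction_transvection_map]
    rfl
  · -- exits: the exit predicate only reads `(i, j, c)`
    rw [List.filter_map, List.length_map]
    rfl
  · -- length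
    exact List.length_map _
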